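import Summits.HodgeConjecture.HodgeConjecture.Theorems.F0P3LettersXiLocalPacketUnitary   -- ★ p823308 (p01 (g8)): the LETTER `XiLocalPacketUnitary` + glue `hFinU_…`
import Summits.HodgeConjecture.HodgeConjecture.Theorems.F0P3bSplitMemberUnitarizable     -- ★ p825402 (F0P3-p01 (g9)): `splitMemberGL_isUnitarizable` = stub (i)
import Summits.HodgeConjecture.HodgeConjecture.Theorems.F0P3bSupercuspidalUnitarizable    -- ★ p825442 (A-p17 (g17)): `isUnitarizable_of_isSupercuspidal` = stub (iii)
import Summits.HodgeConjecture.HodgeConjecture.Theorems.F0P3bLocalNonsplitCompactCenter    -- ★ p825600 (A-p19 (g17)): frame ⇐ «central ⇒ scalar» (`local_nonsplit_compactOpen_center_of_center_le`)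
import Literature.NumberTheory.Automorphic.LocalUnitaryGroupCenter                        -- ★ (A-p19 (g17)): `forall_mem_center_cmLocal_eq_scalar` («central ⇒ scalar» at non-split `v`)
import HarnessLib

/-!
# LINE «XiLocalPacketUnitary» PAY-DOWN — skeleton (REPORT-FIRST; P3b desk, director s554 offer (Ob1))

Cell `hodgecm-mathlib`, F0∕P3 «U3-mult», crux H413 (`stmt-HodgeConjecture-24833`), P3 ledger row 10 (UP) «XiLocalPacketUnitary» [Rogawski1990 §12.2 (1)–(2)
pp. 173–174; Prop. 13.1.3 (d) p. 199; Lemma 4.13.1 (b); BushnellHenniart2006 §11.1] (★ p823308, CITED, k = 1).  Planner F0P3b-plan (g8); publisher F0P3-plan;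
registrar A-plan1.  HONEST LABEL: HC_CM is proved only modulo the printed citations until rung 0 closes; this skeleton discharges NOTHING until its stubs close,
and even then clause (ii) (`stub_keysPn_isUnitarizable`) REMAINS the cited residual — the row stays k = 1 with its content narrowed from three clauses to one.

THE CUT (4 stubs + kernel-checked composition `xiLocalPacketUnitary_of_stubs`):
* `stub_splitMemberGL_isUnitarizable` (L) — clause (i) core: the normalised parabolic induction `i_G(ξ_w) = (ν₀ ∘ det_{GL₂}) × χ′` on `GL₃(F)` from UNIT-NORM
  continuous characters is unitarizable [Casselman1995 Prop. 3.1.4 p. 33; Cartier1979 Thm. 3.2 (c) p. 136; BushnellHenniart2006 §11.1] (duality of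
  induction: [BernsteinZelevinsky1977 Prop. 2.3 (d) p. 446]): the form `⟨f₁, f₂⟩ = ∫_{K₀} conj(f₁ k) · f₂ k dk`
  on `Ind_P^G(σ δ_P^{1/2})`, `G = P · K₀` by ★ `exists_isCompact_isOpen_forall_standardParabolicGL_mul` (the Iwasawa input already in the tree), `G`-invariance by
  the `δ_P`-Jacobian of `k ↦ (kg)_K`.
* `stub_isUnitarizable_of_isSupercuspidal` (S∕M, GENERIC) — clause (iii) core: an irreducible smooth representation of a topological group with a compact open
  subgroup and COMPACT CENTRE whose matrix coefficients are compactly supported modulo the centre (★ `Representation.IsSupercuspidal`, Harish-Chandra) is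
  unitarizable — THE MACHINERY IS ALREADY IN THE TREE (measure-free): ★ `Representation.compactForm` (`Literature/NumberTheory/Automorphic/CompactRepProjective.lean`:
  `B(v, w) = ∫ λ₁(κ(h⁻¹) v) conj(λ₁(κ(h⁻¹) w)) dh` as a finite-sum `lcInt`) with ★ `compactForm_add_left`, ★ `compactForm_smul_left`, ★ `compactForm_conj_symm`
  (Hermitian), ★ `compactForm_apply_apply` (invariance), ★ `formFun_self` + ★ `compactForm_self_ne_zero` (positivity at `λ₁ v ≠ 0`; for general `v ≠ 0` move to
  `κ(h⁻¹) v` with `λ₁(κ(h⁻¹) v) ≠ 0` by irreducibility and use invariance), a smooth `λ₁ ≠ 0` from ★ `CompactOpenAveraging` (`l.comp (ρ.avgProjLinear K hρ hK) ∈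
  ρ.contragredient`); what remains is packaging `B` (swapped) as `V →ₗ⋆[ℂ] V →ₗ[ℂ] ℂ` for ★ `Representation.IsUnitarizable` and `0 < re` from termwise
  non-negativity [Casselman1995 Thm. 5.2.1 + Cor. 5.2.3 pp. 46–47, Prop. 2.5.4 p. 29; BushnellHenniart2006 §10.1–§11.1]; the finite (= compact-modulo-centre)
  representation machinery is [BernsteinZelevinsky1976 §2.39–2.42] (no unitarisability statement is printed there — that step is proved in-house by `K₀`-averaging).
* `stub_local_nonsplit_compactOpen_center` (S∕M) — the frame facts at a NON-split `v`: `G′_v = U(H)(L⁺_v)` has a compact open subgroup (★ `isOpen_localInt` ∕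
  ★ `isCompact_localInt` transported along ★ `localPiEquiv : localPi ≃ₜ* «local»`) and COMPACT CENTRE (`Z = U(1)(L_w ∕ L⁺_v)`, the norm-one scalars; cf. ★
  `LocalUnitaryGroupCongr.localPiNonsplitEquiv`) [Rogawski1990 §12.2 p. 173; PlatonovRapinchuk1994 §3.3, §5.1].  (False at split `v`: `Z ≅ L_w^×`.)
* `stub_keysPn_isUnitarizable` (RESIDUAL, CITED — no prover) — clause (ii) verbatim: the Keys class `πⁿ(ξ_v)` of `U(Φ₃)(L⁺_v)` is unitarizable; `χ_ξ` carries
  `‖·‖^{1/2}` (★ `cmXiTorusChar`), so this is NOT unitary induction but the endpoint of a complementary series ∕ a global automorphy argument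
  [Rogawski1990 §12.2 (2) p. 174; Keys1984] — untyped prerequisites (intertwining operators), stays a letter.

DEF∕PROOF discipline: theorems only, `sorry` ONLY inside the four `stub_*`; no `def`, no instance, no notation; `--supports stmt-HodgeConjecture-24833`.

ED. 2 (publisher F0P3-plan (g6), 2026-08-31): §3 added — the REGISTERED conclusion is the ∀-closure `XiLocalPacketUnitaryClosed` (verbatim the telescope of
`StubXLPU` of ED. 4 §C of `Lines/F0_U3LettersRung1.lean`), because the skeleton auditor (`#h21_check_skeleton`, rule (ii)) reads every `Prop` binder of a
parametrised conclusion (`[NumberField L] [IsCMField L] hH hHd hμu`) as `skeleton.extra-hypothesis`; §1–§2 are byte-identical to the report-first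
afdc52567ddf75ac (REF1 (g6) fidelity GREEN 14:11:38Z).  ED. 5 junction of the rung-1 Lines file: `theorem stub_XLPU : StubXLPU := xiLocalPacketUnitary_closed`.

ED. 3 (drafter F0P3b-plan (g8), 2026-08-31): stubs (i) and (iii) CLOSED BY NAME — `stub_splitMemberGL_isUnitarizable := ★ p825402
`F0P3bSplitMemberUnitarizable.splitMemberGL_isUnitarizable`, `stub_isUnitarizable_of_isSupercuspidal := ★ p825442 `F0P3bSupercuspidalUnitarizable.
isUnitarizable_of_isSupercuspidal`; every statement byte-unchanged; §2 composition and §3 registered head unchanged; open: (frame) [(b1) ★-bound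
`F0P3bLocalNonsplitCompactCenter` + (b2) «central ⇒ scalar»], (ii) RESIDUAL cited.  `sorry` count 4 → 2.

ED. 4 (drafter F0P3b-plan (g8), 2026-08-31): the FRAME stub CLOSED BY NAME — `stub_local_nonsplit_compactOpen_center := ★ p825600
`F0P3bLocalNonsplitCompactCenter.local_nonsplit_compactOpen_center_of_center_le L 3 H hHd v hns (★ UnitaryGroup.forall_mem_center_cmLocal_eq_scalar L H hH hHd v hns)`
(compact open subgroup from the integral level; compact centre because every central element of `U(H)(L⁺_v)` at a non-split `v` is a norm-one scalar); every
statement byte-unchanged; open: ONLY the RESIDUAL (ii) `stub_keysPn_isUnitarizable` (cited, no prover).  `sorry` count 2 → 1 — the line's honest floor.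

ED. 5 (drafter F0P3b-plan (g8), 2026-08-31; DOCSTRING-ONLY, referee F0P3b-ref1 (g0) OBJECTIONS 1 & 3 of `F0/P3b/F0P3b-ref1/REF-L1.F0P3b-ref1-g0.md`):
the unitarity-of-induction source is [Casselman1995 Prop. 3.1.4 p. 33] + [Cartier1979 Thm. 3.2 (c) p. 136] ([BernsteinZelevinsky1977 Prop. 2.3] prints exactness ∕
adjointness ∕ transitivity ∕ duality (d) ∕ admissibility on p. 446 and no positivity clause — kept for (d) only); the cuspidal ⇒ unitary source is [Casselman1995
Thm. 5.2.1 + Cor. 5.2.3 pp. 46–47; Prop. 2.5.4 p. 29] ([BernsteinZelevinsky1976 §2.39–2.42] prints the FINITE-representation machinery, no unitarisability —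
de-quoted).  Pages of Casselman1995 = the UBC draft of 1 May 1995 (materialised `paper:url-3bf54f1701b0`, pp. 29, 33, 46, 47 read).  No declaration touched.
-/

set_option autoImplicit false
set_option linter.dupNamespace false

noncomputable section

open NumberField IsDedekindDomain MeasureTheory
open Literature.NumberTheory.Rogawski1990 Literature.NumberTheory.GaloisRepresentations
open Literature.NumberTheory.Automorphic Literature.NumberTheory.Automorphic.UnitaryGroup
open scoped Matrix Classical

namespace Summit.HodgeConjecture.HodgeConjecture.Cruxes.H413.F0P3bXiLocalPacketUnitaryPaydown

open Summit.HodgeConjecture.HodgeConjecture.Cruxes.H413.F0P3LettersXiLocalPacketUnitary (XiLocalPacketUnitary)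
open Summit.HodgeConjecture.HodgeConjecture.Cruxes.H413.F0P3ClassTokenChoice (isUnitarizable_comap)

/-! ## §1 The four stubs -/

/-- **STUB (i), CLOSED at ED. 3 (★ p825402 `F0P3bSplitMemberUnitarizable.splitMemberGL_isUnitarizable`, Cartier Thm. 3.2 (c) road) — `i_G(ξ_w)` on `GL₃(F)` is unitarizable** (normalised parabolic induction from unit-norm continuous characters `ν₀ ∘ det_{GL₂}`, `χ′`).
[cite: Casselman1995, Prop. 3.1.4 p. 33] [cite: Cartier1979, Thm. 3.2 (c) p. 136] [cite: BernsteinZelevinsky1977, Prop. 2.3 (d) p. 446]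
[cite: BushnellHenniart2006, §11.1] [cite: Rogawski1990, §12.2 (1) p. 173] -/
theorem stub_splitMemberGL_isUnitarizable (F : Type) [Field F] [ValuativeRel F] [TopologicalSpace F] [IsNonarchimedeanLocalField F]
    [LocallyCompactSpace (standardParabolicGL F (Zelevinsky1980.lastBlockLabel 3))]
    (ν₀ χ' : Fˣ →* ℂˣ) (hν₀u : ∀ x, ‖((ν₀ x : ℂˣ) : ℂ)‖ = 1) (hν₀c : Continuous fun x => ((ν₀ x : ℂˣ) : ℂ))
    (hχ'u : ∀ x, ‖((χ' x : ℂˣ) : ℂ)‖ = 1) (hχ'c : Continuous fun x => ((χ' x : ℂˣ) : ℂ)) :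
    (splitMemberGL F ν₀ χ' hν₀u hν₀c hχ'u hχ'c).ρ.IsUnitarizable :=
  F0P3bSplitMemberUnitarizable.splitMemberGL_isUnitarizable F ν₀ χ' hν₀u hν₀c hχ'u hχ'c   -- ★ p825402 (CLOSED, ED. 3)

/-- **STUB (iii), CLOSED at ED. 3 (★ p825442 `F0P3bSupercuspidalUnitarizable.isUnitarizable_of_isSupercuspidal`) — supercuspidal with compact centre ⇒ unitarizable** (GENERIC: any topological group with a compact open subgroup; Harish-Chandra's matrix-coefficient
definition ★ `Representation.IsSupercuspidal`; assemble from ★ `Representation.compactForm` + `compactForm_conj_symm` ∕ `_apply_apply` ∕ `_self_ne_zero` of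
`CompactRepProjective.lean`). [cite: Casselman1995, Thm. 5.2.1, Cor. 5.2.3 pp. 46–47; Prop. 2.5.4 p. 29] [cite: BernsteinZelevinsky1976, §2.39–2.42]
[cite: BushnellHenniart2006, §10.1, §11.1] -/
theorem stub_isUnitarizable_of_isSupercuspidal {G : Type} [Group G] [TopologicalSpace G] [IsTopologicalGroup G]
    {K₀ : Subgroup G} (hK₀o : IsOpen (K₀ : Set G)) (hK₀c : IsCompact (K₀ : Set G))
    (hZ : IsCompact ((Subgroup.center G : Subgroup G) : Set G)) (c : IrrClass G) (hc : c.IsSupercuspidal) : c.IsUnitarizable :=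
  F0P3bSupercuspidalUnitarizable.isUnitarizable_of_isSupercuspidal hK₀o hK₀c hZ c hc   -- ★ p825442 (CLOSED, ED. 3)

variable (L : Type) [Field L] [NumberField L] [IsCMField L] (H : Matrix (Fin 3) (Fin 3) L)

/-- **STUB (frame), CLOSED at ED. 4 (★ p825600 `F0P3bLocalNonsplitCompactCenter.local_nonsplit_compactOpen_center_of_center_le` + ★ `UnitaryGroup.forall_mem_center_cmLocal_eq_scalar`) — at a NON-split finite place `v`, `G′_v = U(H)(L⁺_v)` has a compact open subgroup and COMPACT CENTRE** (`Z(G′_v) = U(1)(L_w∕L⁺_v)`; compact-open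
half: ★ `isOpen_localInt` ∕ ★ `isCompact_localInt` along ★ `localPiEquiv`). [cite: Rogawski1990, §12.2 p. 173] [cite: PlatonovRapinchuk1994, §3.3, §5.1] -/
theorem stub_local_nonsplit_compactOpen_center (hH : (H.map (cmConjRingHom L))ᵀ = H) (hHd : IsUnit H.det)
    (v : HeightOneSpectrum (𝓞 ↥(maximalRealSubfield L))) (hns : ∀ w : PlacesOver L v, IsCMField.complexConj L • w.1 = w.1) :
    (∃ K₀ : Subgroup ((cmDatum L 3 H).Local v), IsOpen (K₀ : Set ((cmDatum L 3 H).Local v)) ∧ IsCompact (K₀ : Set ((cmDatum L 3 H).Local v))) ∧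
      IsCompact ((Subgroup.center ((cmDatum L 3 H).Local v) : Subgroup ((cmDatum L 3 H).Local v)) : Set ((cmDatum L 3 H).Local v)) :=
  F0P3bLocalNonsplitCompactCenter.local_nonsplit_compactOpen_center_of_center_le L 3 H hHd v hns
    (UnitaryGroup.forall_mem_center_cmLocal_eq_scalar L H hH hHd v hns)   -- ★ p825600 + ★ `LocalUnitaryGroupCenter` (CLOSED, ED. 4)

variable (hH : (H.map (cmConjRingHom L))ᵀ = H) (hHd : IsUnit H.det) (μω : HeckeCharacter L) (hμu : μω.IsUnitary)
  [∀ v : HeightOneSpectrum (𝓞 ↥(maximalRealSubfield L)), MeasurableSpace (Gqs L v ⧸ Subgroup.center (Gqs L v))]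
  (μZ : ∀ v : HeightOneSpectrum (𝓞 ↥(maximalRealSubfield L)), Measure (Gqs L v ⧸ Subgroup.center (Gqs L v)))
  (keys : ∀ (ξ : OneDimAutRepH L) (v : HeightOneSpectrum (𝓞 ↥(maximalRealSubfield L))),
    (∀ w : PlacesOver L v, IsCMField.complexConj L • w.1 = w.1) →
      {p : IrrClass (Gqs L v) × IrrClass (Gqs L v) //
        KeysCaseTwoLabels L v (μω.semilocalComponent L v) (torusLocalComponent L (IsCMField.complexConj L) v ξ.η)
          (torusLocalComponent L (IsCMField.complexConj L) v ξ.ψ) p.1 p.2 ∧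
        p.1.IsSquareIntegrable (μZ v) ∧ ¬ p.2.IsSquareIntegrable (μZ v)})

/-- **STUB (ii) — RESIDUAL, CITED (no prover): the Keys class `πⁿ(ξ_v)` is unitarizable at a non-split `v`** (clause (ii) of the letter verbatim; `χ_ξ` has the
`‖·‖^{1/2}` twist, so this is the endpoint of a complementary series, not unitary induction). [cite: Rogawski1990, §12.2 (2) p. 174] [cite: Keys1984, Thm.] -/
theorem stub_keysPn_isUnitarizable :
    ∀ (ξ : OneDimAutRepH L) (v : HeightOneSpectrum (𝓞 ↥(maximalRealSubfield L)))
      (hns : ∀ w : PlacesOver L v, IsCMField.complexConj L • w.1 = w.1), ((keys ξ v hns).1.2).IsUnitarizable := by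
  sorry

/-! ## §2 The kernel-checked composition: the four stub TEXTS imply the letter BY NAME -/

/-- **`XiLocalPacketUnitary` FROM THE STUBS** (composition, no `sorry`): clause (i) = stub (i) transported along `cmSplitEquiv` (★ `cmSplitPacket_πn`, ★ `IrrClass.comap_mk`,
★ `isUnitarizable_comap`); clause (ii) = the residual stub; clause (iii) = the generic stub at the frame facts of the non-split place.
[cite: Rogawski1990, §12.2 (1)–(2) pp. 173–174; §13.1 Prop. 13.1.3 (d) p. 199] -/
theorem xiLocalPacketUnitary_of_stubs
    (h1 : ∀ (F : Type) [Field F] [ValuativeRel F] [TopologicalSpace F] [IsNonarchimedeanLocalField F]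
      [LocallyCompactSpace (standardParabolicGL F (Zelevinsky1980.lastBlockLabel 3))]
      (ν₀ χ' : Fˣ →* ℂˣ) (hν₀u : ∀ x, ‖((ν₀ x : ℂˣ) : ℂ)‖ = 1) (hν₀c : Continuous fun x => ((ν₀ x : ℂˣ) : ℂ))
      (hχ'u : ∀ x, ‖((χ' x : ℂˣ) : ℂ)‖ = 1) (hχ'c : Continuous fun x => ((χ' x : ℂˣ) : ℂ)),
      (splitMemberGL F ν₀ χ' hν₀u hν₀c hχ'u hχ'c).ρ.IsUnitarizable)
    (h3 : ∀ {G : Type} [Group G] [TopologicalSpace G] [IsTopologicalGroup G]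
      {K₀ : Subgroup G}, IsOpen (K₀ : Set G) → IsCompact (K₀ : Set G) →
      IsCompact ((Subgroup.center G : Subgroup G) : Set G) → ∀ c : IrrClass G, c.IsSupercuspidal → c.IsUnitarizable)
    (hfr : ∀ (v : HeightOneSpectrum (𝓞 ↥(maximalRealSubfield L))), (∀ w : PlacesOver L v, IsCMField.complexConj L • w.1 = w.1) →
      (∃ K₀ : Subgroup ((cmDatum L 3 H).Local v), IsOpen (K₀ : Set ((cmDatum L 3 H).Local v)) ∧ IsCompact (K₀ : Set ((cmDatum L 3 H).Local v))) ∧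
        IsCompact ((Subgroup.center ((cmDatum L 3 H).Local v) : Subgroup ((cmDatum L 3 H).Local v)) : Set ((cmDatum L 3 H).Local v)))
    (h2 : ∀ (ξ : OneDimAutRepH L) (v : HeightOneSpectrum (𝓞 ↥(maximalRealSubfield L)))
      (hns : ∀ w : PlacesOver L v, IsCMField.complexConj L • w.1 = w.1), ((keys ξ v hns).1.2).IsUnitarizable) :
    XiLocalPacketUnitary L H hH hHd μω hμu μZ keys := by
  refine ⟨fun ξ v hs => ?_, fun ξ v hns => h2 ξ v hns, fun v hns c hc => ?_⟩
  · rw [cmSplitPacket_πn, ← IrrClass.comap_mk]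
    exact isUnitarizable_comap _ ((IrrClass.isUnitarizable_mk _).2 (h1 _ _ _ _ _ _ _))
  · obtain ⟨⟨K₀, hK₀o, hK₀c⟩, hZ⟩ := hfr v hns
    exact h3 hK₀o hK₀c hZ c hc

/-- **The letter at the stubs of THIS file** (what closes when the three proved stubs close; the residual (ii) stays a hypothesis of record).
[cite: Rogawski1990, §12.2 (1)–(2) pp. 173–174; §13.1 Prop. 13.1.3 (d) p. 199] -/
theorem xiLocalPacketUnitary_holds : XiLocalPacketUnitary L H hH hHd μω hμu μZ keys :=
  xiLocalPacketUnitary_of_stubs L H hH hHd μω hμu μZ keys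
    (fun F _ _ _ _ _ ν₀ χ' hν₀u hν₀c hχ'u hχ'c => stub_splitMemberGL_isUnitarizable F ν₀ χ' hν₀u hν₀c hχ'u hχ'c)
    (fun hK₀o hK₀c hZ c hc => stub_isUnitarizable_of_isSupercuspidal hK₀o hK₀c hZ c hc)
    (fun v hns => stub_local_nonsplit_compactOpen_center L H hH hHd v hns)
    (stub_keysPn_isUnitarizable L μω μZ keys)

/-! ## §3 The closed form for the registry (ED. 2): all frames at once -/

/-- **The letter over ALL frames** — the ∀-closure of `XiLocalPacketUnitary`, character-for-character the telescope of `StubXLPU` (ED. 4 §C of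
`Lines/F0_U3LettersRung1.lean`); this closed `Prop` is the conclusion the skeleton is REGISTERED against (a parametrised conclusion cannot pass rule (ii) of
`#h21_check_skeleton`). [cite: Rogawski1990, §12.2 (1)–(2) pp. 173–174; §13.1 Prop. 13.1.3 (d) p. 199] -/
def XiLocalPacketUnitaryClosed : Prop :=
  ∀ (L : Type) [Field L] [NumberField L] [IsCMField L] (H : Matrix (Fin 3) (Fin 3) L)
    (hH : (H.map (cmConjRingHom L))ᵀ = H) (hHd : IsUnit H.det) (μω : HeckeCharacter L) (hμu : μω.IsUnitary)
    [∀ v : HeightOneSpectrum (𝓞 ↥(maximalRealSubfield L)), MeasurableSpace (Gqs L v ⧸ Subgroup.center (Gqs L v))]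
    (μZ : ∀ v : HeightOneSpectrum (𝓞 ↥(maximalRealSubfield L)), Measure (Gqs L v ⧸ Subgroup.center (Gqs L v)))
    (keys : ∀ (ξ : OneDimAutRepH L) (v : HeightOneSpectrum (𝓞 ↥(maximalRealSubfield L))),
      (∀ w : PlacesOver L v, IsCMField.complexConj L • w.1 = w.1) →
        {p : IrrClass (Gqs L v) × IrrClass (Gqs L v) //
          KeysCaseTwoLabels L v (μω.semilocalComponent L v) (torusLocalComponent L (IsCMField.complexConj L) v ξ.η)
            (torusLocalComponent L (IsCMField.complexConj L) v ξ.ψ) p.1 p.2 ∧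
          p.1.IsSquareIntegrable (μZ v) ∧ ¬ p.2.IsSquareIntegrable (μZ v)}),
    XiLocalPacketUnitary L H hH hHd μω hμu μZ keys

/-- **REGISTERED HEAD (ED. 2)**: the closed letter at the four stubs of this file — `sorry`-free itself; its axioms are TRIO + `sorryAx` exactly until
the three in-house stubs close (the residual (ii) then remains as the one cited `sorryAx` source, honestly labelled).
[cite: Rogawski1990, §12.2 (1)–(2) pp. 173–174; §13.1 Prop. 13.1.3 (d) p. 199] -/
theorem xiLocalPacketUnitary_closed : XiLocalPacketUnitaryClosed :=
  fun L _ _ _ H hH hHd μω hμu _ μZ keys => xiLocalPacketUnitary_holds L H hH hHd μω hμu μZ keys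

end Summit.HodgeConjecture.HodgeConjecture.Cruxes.H413.F0P3bXiLocalPacketUnitaryPaydown

end
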